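import Literature.NumberTheory.Weil1964.RealWeilIndexSeveralVariables
import Literature.Analysis.Distribution.SchwartzUniformTemperateFamily
import HarnessLib

/-!
# Decay of real chirp (Gauss) integrals `∫ e^{2πi ∑ dⱼ xⱼ²} Φ(x) dx` in the coefficients

Topic `NumberTheory/Weil1964`; namespace `Literature.NumberTheory.Weil1964`.  KERNEL mathematics only (theorems; no
definition, no named fact, no `axiom`, no `sorry`).  Sequel of `RealWeilIndexSeveralVariables.lean` (Weil's Théorème 2
for `G = ℝ^ι`, `integral_realChirpPi_mul_fourier_schwartz`).

For a Schwartz function `Φ` on the Euclidean space `V = ℝ^ι` and the DIAGONAL non-degenerate second-degree character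
`f_d(x) = e^{2πi ∑ dⱼ xⱼ²}` (`realChirpPi d`, `dⱼ ≠ 0`), Weil's Théorème 2 `∫ f_d · 𝓕g = γ(f_d) |ρ|^{-1/2} ∫ f̄_{d'} · g`
applied to `g = 𝓕⁻ Φ` gives the ARCHIMEDEAN GAUSS-TRANSFORM BOUND

  `‖∫ f_d(x) Φ(x) dx‖ ≤ (∏ⱼ |2dⱼ|^{-1/2}) · ‖𝓕⁻ Φ‖_{L¹}`   (`norm_integral_realChirpPi_mul_le`),

the archimedean case of [Weil1965, Chap. I n° 2 Prop. 2] ("`|F*_Φ(x*)| ≤ C |x*|^{-m/2}`").  §2 turns it into a bound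
UNIFORM IN A BLOCK SCALING of the coefficients: for blocks `b : ι → W`, fixed weights `aⱼ ≠ 0` and ARBITRARY block
parameters `t : W → ℝ` (zero and small values allowed),

  `‖∫ e^{2πi ∑ⱼ t_{b j} aⱼ xⱼ²} Φ(x) dx‖ ≤ C(Φ, a) · ∏_w max(1, |t_w|)^{-#b⁻¹(w)/2}`   (`exists_norm_integral_realChirpPi_blocks_le`),

by the FINITE-SHIFT TRICK: `t_w = s_w + c_w` with `c_w ∈ {0, 2, -2}` and `|s_w| ≥ max(1, |t_w|)`; the chirp `f_{c∘b · a}` is absorbed into `Φ` (temperate growth, ★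
`hasTemperateGrowth_realChirpPi_euclidean`), leaving only `3^{|W|}` Schwartz functions and a NON-DEGENERATE character
`f_{s∘b · a}` to which §1 applies.  With `W` = the real places of a totally real field and `b⁻¹(w)` = the `m` coordinates
at `w` this is the archimedean factor `∏_{w ∣ ∞} max(1, |η_w|)^{-m/2}` of the adelic Gauss-transform majorant
(`AdelicGaussTransformMajorant.lean`; [Weil1965, n° 40 Thm. 1 (p. 57), condition (B)]).

Cell `hodgecm-mathlib`, FLOOR 0, crux H413 (stmt-HodgeConjecture-24833), E-2 ∕ SW2c-BOUND sheet §2 letter (E1), archimedean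
half.  HC_CM is proved only modulo the 7 printed citations until rung 0 closes; this file is unconditional.

## References
* [Weil1964] A. Weil, *Sur certains groupes d'opérateurs unitaires*, Acta Math. 111 (1964): Chap. I n° 14 Thm 2, p. 161.
* [Weil1965] A. Weil, *Sur la formule de Siegel dans la théorie des groupes classiques*, Acta Math. 113 (1965): Chap. I
  n° 2 Prop. 2 (p. 8); n° 40 Thm. 1 (p. 57).
-/

set_option autoImplicit false

noncomputable section

open MeasureTheory Complex Filter Topology Set Finset
open scoped Real FourierTransform SchwartzMap BigOperators

namespace Literature.NumberTheory.Weil1964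

variable {ι : Type*} [Fintype ι]

/-! ## §1 The non-degenerate bound `‖∫ f_d Φ‖ ≤ ∏|2dⱼ|^{-1/2} · ‖𝓕⁻Φ‖₁` -/

/-- the second-degree characters multiply under addition of the coefficients: `f_{c+c'} = f_c f_{c'}`.
[cite: Weil1964, Chap. I n° 2, p. 147] -/
theorem realChirpPi_add_left (c c' x : ι → ℝ) : realChirpPi (c + c') x = realChirpPi c x * realChirpPi c' x := by
  rw [realChirpPi_eq_cexp_sum, realChirpPi_eq_cexp_sum, realChirpPi_eq_cexp_sum, ← Complex.exp_add, ← mul_add,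
    ← Finset.sum_add_distrib]
  congr 2
  refine Finset.sum_congr rfl fun i _ => ?_
  rw [Pi.add_apply]
  push_cast
  ring

/-- `‖∫ f_c(x) g(x) dx‖ ≤ ∫ ‖g‖` since `|f_c| = 1`. [cite: Weil1964, Chap. I n° 2, p. 147] -/
theorem norm_integral_realChirpPi_mul_le_integral_norm (c : ι → ℝ) (g : EuclideanSpace ℝ ι → ℂ) :
    ‖∫ x : EuclideanSpace ℝ ι, realChirpPi c x * g x‖ ≤ ∫ x : EuclideanSpace ℝ ι, ‖g x‖ := by
  refine (norm_integral_le_integral_norm _).trans (le_of_eq ?_)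
  congr 1
  funext x
  rw [norm_mul, norm_realChirpPi, one_mul]

/-- **THE ARCHIMEDEAN GAUSS-TRANSFORM BOUND** (Weil's Théorème 2 read as an estimate): for `dⱼ ≠ 0` and every
Schwartz `Φ` on `ℝ^ι`, `‖∫ e^{2πi ∑ dⱼ xⱼ²} Φ(x) dx‖ ≤ (∏ⱼ |2dⱼ|^{-1/2}) · ∫ ‖𝓕⁻Φ‖`.
[cite: Weil1964, Chap. I n° 14 Thm 2, p. 161] [cite: Weil1965, Chap. I n° 2 Prop. 2, p. 8] -/
theorem norm_integral_realChirpPi_mul_le {d : ι → ℝ} (hd : ∀ i, d i ≠ 0) (Φ : 𝓢(EuclideanSpace ℝ ι, ℂ)) :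
    ‖∫ x : EuclideanSpace ℝ ι, realChirpPi d x * Φ x‖ ≤
      (∏ i, |2 * d i| ^ (-(1 / 2 : ℝ))) * ∫ x : EuclideanSpace ℝ ι, ‖(𝓕⁻ Φ : 𝓢(EuclideanSpace ℝ ι, ℂ)) x‖ := by
  have hΦ : (⇑Φ : EuclideanSpace ℝ ι → ℂ) = 𝓕 (⇑(𝓕⁻ Φ : 𝓢(EuclideanSpace ℝ ι, ℂ)) : EuclideanSpace ℝ ι → ℂ) := by
    rw [← SchwartzMap.fourier_coe, FourierTransform.fourier_fourierInv_eq]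
  have hprod : 0 ≤ ∏ i, |2 * d i| ^ (-(1 / 2 : ℝ)) :=
    Finset.prod_nonneg fun i _ => Real.rpow_nonneg (abs_nonneg _) _
  rw [hΦ, integral_realChirpPi_mul_fourier_schwartz hd (𝓕⁻ Φ : 𝓢(EuclideanSpace ℝ ι, ℂ)), norm_mul, norm_mul, norm_realWeilIndexPi, one_mul,
    Complex.norm_real, Real.norm_of_nonneg hprod]
  exact mul_le_mul_of_nonneg_left (norm_integral_realChirpPi_mul_le_integral_norm _ _) hprod

/-! ## §2 Block scalings: `‖∫ e^{2πi ∑ t_{bj} aⱼ xⱼ²} Φ‖ ≤ C · ∏_w max(1,|t_w|)^{-#b⁻¹(w)/2}` for ALL `t` -/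

variable {W : Type*} [Fintype W] [DecidableEq W]

/-- regrouping a product over `ι` along the blocks `b : ι → W`: `∏ⱼ g(b j) = ∏_w g(w)^{#b⁻¹(w)}`. [folklore] -/
private theorem prod_comp_blocks_eq_prod_pow (b : ι → W) (g : W → ℝ) :
    ∏ j, g (b j) = ∏ w, g w ^ (Finset.univ.filter fun j => b j = w).card := by
  rw [← Finset.prod_fiberwise_of_maps_to (s := Finset.univ) (t := Finset.univ) (g := b)
    (fun j _ => Finset.mem_univ (b j)) (f := fun j => g (b j))]
  refine Finset.prod_congr rfl fun w _ => ?_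
  rw [← Finset.prod_const]
  refine Finset.prod_congr rfl fun j hj => ?_
  rw [(Finset.mem_filter.1 hj).2]

/-- **BLOCK-SCALING DECAY OF REAL CHIRP INTEGRALS, UNIFORM IN THE SCALING**: for blocks `b : ι → W`, weights `aⱼ ≠ 0`
and a Schwartz `Φ` on `ℝ^ι` there is `C ≥ 0` with, for EVERY `t : W → ℝ`,
`‖∫ e^{2πi ∑ⱼ t_{b j} aⱼ xⱼ²} Φ(x) dx‖ ≤ C · ∏_w max(1, |t_w|)^{-#b⁻¹(w)/2}` — the finite-shift trick `t = s + c`,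
`c_w ∈ {0, 2, -2}`, `|s_w| ≥ max(1,|t_w|)`, the chirp `f_{c∘b·a}` absorbed into `Φ`, then §1 for the non-degenerate `f_{s∘b·a}`.
[cite: Weil1965, Chap. I n° 2 Prop. 2, p. 8; n° 40 Thm. 1, p. 57] [cite: Weil1964, Chap. I n° 14 Thm 2, p. 161] -/
theorem exists_norm_integral_realChirpPi_blocks_le (b : ι → W) {a : ι → ℝ} (ha : ∀ j, a j ≠ 0)
    (Φ : 𝓢(EuclideanSpace ℝ ι, ℂ)) :
    ∃ C : ℝ, 0 ≤ C ∧ ∀ t : W → ℝ,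
      ‖∫ x : EuclideanSpace ℝ ι, realChirpPi (fun j => t (b j) * a j) x * Φ x‖ ≤
        C * ∏ w, (max 1 |t w|) ^ (-(((Finset.univ.filter fun j => b j = w).card : ℝ) / 2)) := by
  classical
  -- the chirped Schwartz functions `Φ_c = f_{c∘b·a} · Φ`
  set Φc : (W → ℝ) → 𝓢(EuclideanSpace ℝ ι, ℂ) := fun c =>
    SchwartzMap.smulLeftCLM ℂ (fun v : EuclideanSpace ℝ ι => realChirpPi (fun j => c (b j) * a j) v) Φ with hΦc
  have hΦc_apply : ∀ (c : W → ℝ) (v : EuclideanSpace ℝ ι),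
      Φc c v = realChirpPi (fun j => c (b j) * a j) v * Φ v := fun c v => by
    rw [hΦc, SchwartzMap.smulLeftCLM_apply_apply (hasTemperateGrowth_realChirpPi_euclidean _), smul_eq_mul]
  set S : Finset (W → ℝ) := Fintype.piFinset fun _ : W => ({0, 2, -2} : Finset ℝ) with hS
  set A : ℝ := ∏ j, |2 * a j| ^ (-(1 / 2 : ℝ)) with hA
  have hA0 : 0 ≤ A := Finset.prod_nonneg fun j _ => Real.rpow_nonneg (abs_nonneg _) _
  set B : ℝ := ∑ c ∈ S, ∫ x : EuclideanSpace ℝ ι, ‖(𝓕⁻ (Φc c) : 𝓢(EuclideanSpace ℝ ι, ℂ)) x‖ with hB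
  have hBterm : ∀ c, 0 ≤ ∫ x : EuclideanSpace ℝ ι, ‖(𝓕⁻ (Φc c) : 𝓢(EuclideanSpace ℝ ι, ℂ)) x‖ := fun c =>
    integral_nonneg fun x => norm_nonneg _
  have hB0 : 0 ≤ B := Finset.sum_nonneg fun c _ => hBterm c
  refine ⟨A * B, mul_nonneg hA0 hB0, fun t => ?_⟩
  -- the finite shift `t = s + c`, `c_w ∈ {0, 2, -2}`, `|s_w| ≥ max(1, |t_w|)`
  set c : W → ℝ := fun w => if 1 ≤ |t w| then 0 else if 0 ≤ t w then -2 else 2 with hc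
  set s : W → ℝ := fun w => t w - c w with hs
  have hcS : c ∈ S := by
    refine Fintype.mem_piFinset.2 fun w => ?_
    simp only [hc]
    split_ifs <;> simp
  have hs_ge : ∀ w, max 1 |t w| ≤ |s w| := fun w => by
    simp only [hs, hc]
    split_ifs with h1 h2
    · rw [sub_zero, max_eq_right h1]
    · rw [not_le] at h1
      rw [max_eq_left h1.le, sub_neg_eq_add]
      rw [abs_lt] at h1
      rw [abs_of_nonneg (by linarith)]
      linarith
    · rw [not_le] at h1 h2
      rw [max_eq_left h1.le]
      rw [abs_lt] at h1
      rw [abs_of_neg (by linarith)]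
      linarith
  have hs_ne : ∀ w, s w ≠ 0 := fun w => by
    rw [← abs_pos]
    exact lt_of_lt_of_le (lt_of_lt_of_le zero_lt_one (le_max_left _ _)) (hs_ge w)
  have hs_rpow : ∀ (w) {r : ℝ}, 0 ≤ r → |s w| ^ (-r) ≤ (max 1 |t w|) ^ (-r) := fun w r hr =>
    Real.rpow_le_rpow_of_nonpos (lt_of_lt_of_le zero_lt_one (le_max_left _ _)) (hs_ge w) (neg_nonpos.2 hr)
  have hts : (fun j => t (b j) * a j) = (fun j => s (b j) * a j) + fun j => c (b j) * a j := by
    funext j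
    rw [Pi.add_apply, hs]
    ring
  have hsa : ∀ j, s (b j) * a j ≠ 0 := fun j => mul_ne_zero (hs_ne _) (ha j)
  have hint : (fun x : EuclideanSpace ℝ ι => realChirpPi (fun j => t (b j) * a j) x * Φ x) =
      fun x : EuclideanSpace ℝ ι => realChirpPi (fun j => s (b j) * a j) x * Φc c x := by
    funext x
    rw [hts, realChirpPi_add_left, hΦc_apply, mul_assoc]
  rw [hint]
  refine (norm_integral_realChirpPi_mul_le hsa (Φc c)).trans ?_
  -- the constant `∏ⱼ |2 s_{bj} aⱼ|^{-1/2} = (∏_w |s_w|^{-n_w/2}) · A ≤ (∏_w max(1,|t_w|)^{-n_w/2}) · A`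
  have hsplit : ∏ j, |2 * (s (b j) * a j)| ^ (-(1 / 2 : ℝ)) =
      (∏ j, |s (b j)| ^ (-(1 / 2 : ℝ))) * A := by
    rw [hA, ← Finset.prod_mul_distrib]
    refine Finset.prod_congr rfl fun j _ => ?_
    rw [show 2 * (s (b j) * a j) = s (b j) * (2 * a j) by ring, abs_mul,
      Real.mul_rpow (abs_nonneg _) (abs_nonneg _)]
  have hblocks : ∏ j, |s (b j)| ^ (-(1 / 2 : ℝ)) =
      ∏ w, |s w| ^ (-(((Finset.univ.filter fun j => b j = w).card : ℝ) / 2)) := by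
    rw [prod_comp_blocks_eq_prod_pow b (fun w => |s w| ^ (-(1 / 2 : ℝ)))]
    refine Finset.prod_congr rfl fun w _ => ?_
    rw [← Real.rpow_natCast, ← Real.rpow_mul (abs_nonneg _)]
    congr 1
    ring
  have hle : ∏ w, |s w| ^ (-(((Finset.univ.filter fun j => b j = w).card : ℝ) / 2)) ≤
      ∏ w, (max 1 |t w|) ^ (-(((Finset.univ.filter fun j => b j = w).card : ℝ) / 2)) := by
    refine Finset.prod_le_prod (fun w _ => Real.rpow_nonneg (abs_nonneg _) _) fun w _ => ?_
    exact hs_rpow w (r := ((Finset.univ.filter fun j => b j = w).card : ℝ) / 2) (by positivity)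
  have hBle : ∫ x : EuclideanSpace ℝ ι, ‖(𝓕⁻ (Φc c) : 𝓢(EuclideanSpace ℝ ι, ℂ)) x‖ ≤ B :=
    Finset.single_le_sum (f := fun c => ∫ x : EuclideanSpace ℝ ι, ‖(𝓕⁻ (Φc c) : 𝓢(EuclideanSpace ℝ ι, ℂ)) x‖) (fun c _ => hBterm c) hcS
  have hmax0 : 0 ≤ ∏ w, (max 1 |t w|) ^ (-(((Finset.univ.filter fun j => b j = w).card : ℝ) / 2)) :=
    Finset.prod_nonneg fun w _ => Real.rpow_nonneg (le_trans zero_le_one (le_max_left _ _)) _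
  rw [hsplit, hblocks]
  calc (∏ w, |s w| ^ (-(((Finset.univ.filter fun j => b j = w).card : ℝ) / 2))) * A *
        ∫ x : EuclideanSpace ℝ ι, ‖(𝓕⁻ (Φc c) : 𝓢(EuclideanSpace ℝ ι, ℂ)) x‖
      ≤ (∏ w, (max 1 |t w|) ^ (-(((Finset.univ.filter fun j => b j = w).card : ℝ) / 2))) * A * B := by
        gcongr
    _ = A * B * ∏ w, (max 1 |t w|) ^ (-(((Finset.univ.filter fun j => b j = w).card : ℝ) / 2)) := by ring

/-! ## §3 (EDITION 2) The constant written out, and a FAMILY version with uniformly bounded Schwartz seminorms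

For the (D-E)-type consumers (a family `{Φ_c}_{c ∈ S}` with uniformly bounded Schwartz seminorms — e.g. archimedean cut-offs
`Φ · β_n` — must get ONE constant): the constant of `exists_norm_integral_realChirpPi_blocks_le` is the explicit
`(∏ⱼ |2aⱼ|^{-1/2}) · Σ_{c ∈ {0,±2}^W} ‖𝓕⁻(f_{c∘b·a} Φ)‖_{L¹}` (`norm_integral_realChirpPi_blocks_le_explicit`), a finite sum of
`L¹`-norms of images of `Φ` under CONTINUOUS linear endomorphisms of `𝓢`, hence bounded on every family with uniformly bounded
seminorms (★ `Literature.Analysis.Distribution.exists_forall_seminorm_le_of_uniform`, Mathlib `SchwartzMap.norm_toLp_le_seminorm`). -/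

/-- **the block bound with its constant written out**: for every `t`,
`‖∫ e^{2πi ∑ⱼ t_{bj} aⱼ xⱼ²} Φ‖ ≤ (∏ⱼ |2aⱼ|^{-1/2}) · (Σ_{c ∈ {0,2,-2}^W} ∫ ‖𝓕⁻(f_{c∘b·a} · Φ)‖) · ∏_w max(1,|t_w|)^{-#b⁻¹(w)/2}`.
[cite: Weil1965, Chap. I n° 2 Prop. 2, p. 8; n° 40 Thm. 1, p. 57] [cite: Weil1964, Chap. I n° 14 Thm 2, p. 161] -/
theorem norm_integral_realChirpPi_blocks_le_explicit (b : ι → W) {a : ι → ℝ} (ha : ∀ j, a j ≠ 0)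
    (Φ : 𝓢(EuclideanSpace ℝ ι, ℂ)) (t : W → ℝ) :
    ‖∫ x : EuclideanSpace ℝ ι, realChirpPi (fun j => t (b j) * a j) x * Φ x‖ ≤
      ((∏ j, |2 * a j| ^ (-(1 / 2 : ℝ))) *
        ∑ c ∈ Fintype.piFinset fun _ : W => ({0, 2, -2} : Finset ℝ),
          ∫ x : EuclideanSpace ℝ ι, ‖(𝓕⁻ (SchwartzMap.smulLeftCLM ℂ
            (fun v : EuclideanSpace ℝ ι => realChirpPi (fun j => c (b j) * a j) v) Φ) : 𝓢(EuclideanSpace ℝ ι, ℂ)) x‖) *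
        ∏ w, (max 1 |t w|) ^ (-(((Finset.univ.filter fun j => b j = w).card : ℝ) / 2)) := by
  classical
  set Φc : (W → ℝ) → 𝓢(EuclideanSpace ℝ ι, ℂ) := fun c =>
    SchwartzMap.smulLeftCLM ℂ (fun v : EuclideanSpace ℝ ι => realChirpPi (fun j => c (b j) * a j) v) Φ with hΦc
  have hΦc_apply : ∀ (c : W → ℝ) (v : EuclideanSpace ℝ ι),
      Φc c v = realChirpPi (fun j => c (b j) * a j) v * Φ v := fun c v => by
    rw [hΦc, SchwartzMap.smulLeftCLM_apply_apply (hasTemperateGrowth_realChirpPi_euclidean _), smul_eq_mul]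
  set S : Finset (W → ℝ) := Fintype.piFinset fun _ : W => ({0, 2, -2} : Finset ℝ) with hS
  set A : ℝ := ∏ j, |2 * a j| ^ (-(1 / 2 : ℝ)) with hA
  have hA0 : 0 ≤ A := Finset.prod_nonneg fun j _ => Real.rpow_nonneg (abs_nonneg _) _
  set B : ℝ := ∑ c ∈ S, ∫ x : EuclideanSpace ℝ ι, ‖(𝓕⁻ (Φc c) : 𝓢(EuclideanSpace ℝ ι, ℂ)) x‖ with hB
  have hBterm : ∀ c, 0 ≤ ∫ x : EuclideanSpace ℝ ι, ‖(𝓕⁻ (Φc c) : 𝓢(EuclideanSpace ℝ ι, ℂ)) x‖ := fun c =>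
    integral_nonneg fun x => norm_nonneg _
  show _ ≤ A * B * _
  -- the finite shift `t = s + c`, `c_w ∈ {0, 2, -2}`, `|s_w| ≥ max(1, |t_w|)`
  set c : W → ℝ := fun w => if 1 ≤ |t w| then 0 else if 0 ≤ t w then -2 else 2 with hc
  set s : W → ℝ := fun w => t w - c w with hs
  have hcS : c ∈ S := by
    refine Fintype.mem_piFinset.2 fun w => ?_
    simp only [hc]
    split_ifs <;> simp
  have hs_ge : ∀ w, max 1 |t w| ≤ |s w| := fun w => by
    simp only [hs, hc]
    split_ifs with h1 h2
    · rw [sub_zero, max_eq_right h1]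
    · rw [not_le] at h1
      rw [max_eq_left h1.le, sub_neg_eq_add]
      rw [abs_lt] at h1
      rw [abs_of_nonneg (by linarith)]
      linarith
    · rw [not_le] at h1 h2
      rw [max_eq_left h1.le]
      rw [abs_lt] at h1
      rw [abs_of_neg (by linarith)]
      linarith
  have hs_ne : ∀ w, s w ≠ 0 := fun w => by
    rw [← abs_pos]
    exact lt_of_lt_of_le (lt_of_lt_of_le zero_lt_one (le_max_left _ _)) (hs_ge w)
  have hs_rpow : ∀ (w) {r : ℝ}, 0 ≤ r → |s w| ^ (-r) ≤ (max 1 |t w|) ^ (-r) := fun w r hr =>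
    Real.rpow_le_rpow_of_nonpos (lt_of_lt_of_le zero_lt_one (le_max_left _ _)) (hs_ge w) (neg_nonpos.2 hr)
  have hts : (fun j => t (b j) * a j) = (fun j => s (b j) * a j) + fun j => c (b j) * a j := by
    funext j
    rw [Pi.add_apply, hs]
    ring
  have hsa : ∀ j, s (b j) * a j ≠ 0 := fun j => mul_ne_zero (hs_ne _) (ha j)
  have hint : (fun x : EuclideanSpace ℝ ι => realChirpPi (fun j => t (b j) * a j) x * Φ x) =
      fun x : EuclideanSpace ℝ ι => realChirpPi (fun j => s (b j) * a j) x * Φc c x := by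
    funext x
    rw [hts, realChirpPi_add_left, hΦc_apply, mul_assoc]
  rw [hint]
  refine (norm_integral_realChirpPi_mul_le hsa (Φc c)).trans ?_
  have hsplit : ∏ j, |2 * (s (b j) * a j)| ^ (-(1 / 2 : ℝ)) =
      (∏ j, |s (b j)| ^ (-(1 / 2 : ℝ))) * A := by
    rw [hA, ← Finset.prod_mul_distrib]
    refine Finset.prod_congr rfl fun j _ => ?_
    rw [show 2 * (s (b j) * a j) = s (b j) * (2 * a j) by ring, abs_mul,
      Real.mul_rpow (abs_nonneg _) (abs_nonneg _)]
  have hblocks : ∏ j, |s (b j)| ^ (-(1 / 2 : ℝ)) =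
      ∏ w, |s w| ^ (-(((Finset.univ.filter fun j => b j = w).card : ℝ) / 2)) := by
    rw [prod_comp_blocks_eq_prod_pow b (fun w => |s w| ^ (-(1 / 2 : ℝ)))]
    refine Finset.prod_congr rfl fun w _ => ?_
    rw [← Real.rpow_natCast, ← Real.rpow_mul (abs_nonneg _)]
    congr 1
    ring
  have hle : ∏ w, |s w| ^ (-(((Finset.univ.filter fun j => b j = w).card : ℝ) / 2)) ≤
      ∏ w, (max 1 |t w|) ^ (-(((Finset.univ.filter fun j => b j = w).card : ℝ) / 2)) := by
    refine Finset.prod_le_prod (fun w _ => Real.rpow_nonneg (abs_nonneg _) _) fun w _ => ?_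
    exact hs_rpow w (r := ((Finset.univ.filter fun j => b j = w).card : ℝ) / 2) (by positivity)
  have hBle : ∫ x : EuclideanSpace ℝ ι, ‖(𝓕⁻ (Φc c) : 𝓢(EuclideanSpace ℝ ι, ℂ)) x‖ ≤ B :=
    Finset.single_le_sum (f := fun c => ∫ x : EuclideanSpace ℝ ι, ‖(𝓕⁻ (Φc c) : 𝓢(EuclideanSpace ℝ ι, ℂ)) x‖)
      (fun c _ => hBterm c) hcS
  rw [hsplit, hblocks]
  calc (∏ w, |s w| ^ (-(((Finset.univ.filter fun j => b j = w).card : ℝ) / 2))) * A *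
        ∫ x : EuclideanSpace ℝ ι, ‖(𝓕⁻ (Φc c) : 𝓢(EuclideanSpace ℝ ι, ℂ)) x‖
      ≤ (∏ w, (max 1 |t w|) ^ (-(((Finset.univ.filter fun j => b j = w).card : ℝ) / 2))) * A * B := by
        gcongr
    _ = A * B * ∏ w, (max 1 |t w|) ^ (-(((Finset.univ.filter fun j => b j = w).card : ℝ) / 2)) := by ring

/-- **FAMILY VERSION (uniformly bounded Schwartz seminorms ⇒ ONE constant)**: for a family `Φ_c ∈ 𝓢(ℝ^ι)`, `c ∈ S`, with
uniformly bounded Schwartz seminorms there is `C ≥ 0` with, for every `c ∈ S` and EVERY `t : W → ℝ`,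
`‖∫ e^{2πi ∑ⱼ t_{bj} aⱼ xⱼ²} Φ_c(x) dx‖ ≤ C · ∏_w max(1, |t_w|)^{-#b⁻¹(w)/2}` — `Φ ↦ 𝓕⁻(f · Φ)` is a continuous endomorphism of `𝓢`,
so its `L¹`-norm is controlled by finitely many seminorms (★ `exists_forall_seminorm_le_of_uniform`).
[cite: Weil1965, Chap. I n° 2 Prop. 2, p. 8; n° 40 Thm. 1, p. 57] [cite: HormanderALPDO1, §7.1] -/
theorem exists_norm_integral_realChirpPi_blocks_le_of_uniform (b : ι → W) {a : ι → ℝ} (ha : ∀ j, a j ≠ 0)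
    {κ : Type*} {S : Set κ} {Φ : κ → 𝓢(EuclideanSpace ℝ ι, ℂ)}
    (hΦ : ∀ p : ℕ × ℕ, ∃ M : ℝ, ∀ c ∈ S, SchwartzMap.seminorm ℂ p.1 p.2 (Φ c) ≤ M) :
    ∃ C : ℝ, 0 ≤ C ∧ ∀ c ∈ S, ∀ t : W → ℝ,
      ‖∫ x : EuclideanSpace ℝ ι, realChirpPi (fun j => t (b j) * a j) x * Φ c x‖ ≤
        C * ∏ w, (max 1 |t w|) ^ (-(((Finset.univ.filter fun j => b j = w).card : ℝ) / 2)) := by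
  classical
  -- the continuous endomorphisms `Φ ↦ 𝓕⁻ (f_{e∘b·a} Φ)` of `𝓢`, one for each shift `e`
  set T : (W → ℝ) → 𝓢(EuclideanSpace ℝ ι, ℂ) →L[ℂ] 𝓢(EuclideanSpace ℝ ι, ℂ) := fun e =>
    (SchwartzMap.compCLMOfContinuousLinearEquiv ℂ (LinearIsometryEquiv.neg ℝ (E := EuclideanSpace ℝ ι))).comp
      ((SchwartzMap.fourierTransformCLM ℂ).comp
        (SchwartzMap.smulLeftCLM ℂ (fun v : EuclideanSpace ℝ ι => realChirpPi (fun j => e (b j) * a j) v))) with hT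
  have hT_apply : ∀ e (Ψ : 𝓢(EuclideanSpace ℝ ι, ℂ)),
      T e Ψ = (𝓕⁻ (SchwartzMap.smulLeftCLM ℂ (fun v : EuclideanSpace ℝ ι => realChirpPi (fun j => e (b j) * a j) v) Ψ) :
        𝓢(EuclideanSpace ℝ ι, ℂ)) := fun e Ψ => by
    rw [hT, ContinuousLinearMap.comp_apply, ContinuousLinearMap.comp_apply, SchwartzMap.fourierInv_apply_eq,
      SchwartzMap.fourierTransformCLM_apply]
  -- `L¹` norms are controlled by finitely many seminorms, which are uniformly bounded on the family
  obtain ⟨k, C₁, hC₁0, hL1⟩ := SchwartzMap.norm_toLp_le_seminorm ℂ ℂ (E := EuclideanSpace ℝ ι) 1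
    (volume : Measure (EuclideanSpace ℝ ι))
  have hbound : ∀ e : W → ℝ, ∃ M : ℝ, ∀ c ∈ S,
      ∫ x : EuclideanSpace ℝ ι, ‖(𝓕⁻ (SchwartzMap.smulLeftCLM ℂ
        (fun v : EuclideanSpace ℝ ι => realChirpPi (fun j => e (b j) * a j) v) (Φ c)) : 𝓢(EuclideanSpace ℝ ι, ℂ)) x‖ ≤ M := by
    intro e
    choose M' hM' using fun p : ℕ × ℕ =>
      Literature.Analysis.Distribution.exists_forall_seminorm_le_of_uniform (𝕜 := ℂ) (T e) hΦ p
    refine ⟨C₁ * ∑ p ∈ Finset.Iic (k, 0), |M' p|, fun c hc => ?_⟩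
    rw [← hT_apply, ← SchwartzMap.norm_toLp_one (μ := (volume : Measure (EuclideanSpace ℝ ι)))]
    refine (hL1 (T e (Φ c))).trans (mul_le_mul_of_nonneg_left ?_ hC₁0)
    exact Seminorm.finset_sup_apply_le (Finset.sum_nonneg fun i _ => abs_nonneg (M' i)) fun i hi =>
      ((hM' i c hc).trans (le_abs_self (M' i))).trans (Finset.single_le_sum (fun j _ => abs_nonneg (M' j)) hi)
  choose M hM using hbound
  set A : ℝ := ∏ j, |2 * a j| ^ (-(1 / 2 : ℝ)) with hA
  have hA0 : 0 ≤ A := Finset.prod_nonneg fun j _ => Real.rpow_nonneg (abs_nonneg _) _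
  set B : ℝ := ∑ e ∈ Fintype.piFinset (fun _ : W => ({0, 2, -2} : Finset ℝ)), |M e| with hB
  have hB0 : 0 ≤ B := Finset.sum_nonneg fun e _ => abs_nonneg _
  refine ⟨A * B, mul_nonneg hA0 hB0, fun c hc t => ?_⟩
  refine (norm_integral_realChirpPi_blocks_le_explicit b ha (Φ c) t).trans ?_
  have hprod0 : 0 ≤ ∏ w, (max 1 |t w|) ^ (-(((Finset.univ.filter fun j => b j = w).card : ℝ) / 2)) :=
    Finset.prod_nonneg fun w _ => Real.rpow_nonneg (le_trans zero_le_one (le_max_left _ _)) _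
  refine mul_le_mul_of_nonneg_right (mul_le_mul_of_nonneg_left ?_ hA0) hprod0
  exact Finset.sum_le_sum fun e _ => (hM e c hc).trans (le_abs_self _)

end Literature.NumberTheory.Weil1964

end
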